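import Summits.QuantumFields.BalabanUV.T4Continuum.Spine.NE1p.DressedSmallFieldLinkMu
import Summits.QuantumFields.BalabanUV.T4Continuum.Support.TorusBlockRefinement

/-!
# T⁴ programme, spine estimate NE1′ (node O3b/H2) — THE μ-TWIN OF S48: N0x PART 2's INNER-LABEL μ-END ON pv22's NESTED TORI `(N, L·N)`
# WITH BOTH GEOMETRIC BINDERS SUPPLIED — the footprint map `foot := trefineDom L N` with `hmono` (S43.1, [Dimock2013] Lemma 10 BY NAME)
# AND the (2.27)∘(2.32) link (S66 §1 `…innerLabels_of_units` ∕ S40.1 `link_of_ineq227` at the FINE torus's unit cubes, `c₃₂ = 5`):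
# the source-pencil output at the inner-label index of the REFINED footprint — NO footprint map, NO `hmono`, NO link binder, NO geometry
# hypothesis

Cell `pub-balaban`, sub-cell `t4`, BINDER-OWNERS row NE1′ (owner lineage t4-ne1p-p1, road P1 «RG-trajectory comparison … μ-uniformity
through the printed small-field bounds»); crew seat `b2b-balaban-t4-ne1p-formalise-leaf-07` (LEAF PROVER 07, generation 20); crew
S-row **S68 ∕ DAG N29zzzzzt** (own-initiative follower of this seat's S66 = DAG N29zzzzzk «THE μ-TWIN OF S40» under R-T61 (ii), exactly
as S48 (`DressedSmallFieldInnerLabelsRefined`, leaf-05 g11) is S40.1 §3's nested-tori face; INTENT `HOME/CLAIMS.log` l.25208, GO leaf-05-g13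
l.25219, BOOKED typer gen 9 **R-T155** l.25330 (cap 180, ONE kernel slot at PROPOSED); cross-read **X250**).  S43.1's two lemmas USED BY
NAME: `trefineDom` (the footprint map) and `torusTreeLen_le_trefine` (`hmono`).  ADDITIVE — imports S66 `Spine/NE1p/DressedSmallFieldLinkMu` (p244344 ✓✓; → the owner's N0x PART 2
`DressedSmallFieldLabelCountsMu`, S40.1 `DressedSmallFieldInnerLink`, N0o `torus_consts`, S24 `K₀_four`) and S43 PART 1
`Support/TorusBlockRefinement` (`trefineDom`, `torusTreeLen_le_trefine`) ONLY; THEOREMS ONLY (0 `def`, 0 `def … : Prop`, 0 cite); nothing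
of N0x ∕ N0u ∕ S66 ∕ S40 ∕ S43 ∕ S48 ∕ S24 ∕ N0o ∕ pv22 restated — their declarations are used BY NAME.

WHY THIS FILE.  S66 §3 reads N0x PART 2's inner-label μ-END on ONE torus (`G = Gk := tgeometry 4 N`, `foot := id`, `hmono := le_rfl`)
with the link DISCHARGED; S43.1 constructed the refinement `trefineDom L N : (tsys 4 N).Dom → (tsys 4 (L·N)).Dom` between pv22's NESTED
tori and discharged `hmono` by exact coarsening ([Dimock2013] §3 Lemma 10 through pv22's `mul_torusTreeLen_image_le`); S48 composed the
two for the ATTACHED part.  THIS FILE is S48's μ-twin: **`muPart_locE_le_of_coresAt_pencil_innerLabels_refined`** = S66 §1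
`muPart_locE_le_of_coresAt_pencil_innerLabels_of_units` ONCE BY NAME at `D := tsys 4 N`, `G := tgeometry 4 N`, `Dk := tsys 4 (L·N)`,
`Gk := tgeometry 4 (L·N)`, `foot := trefineDom L N`, `hmono := torusTreeLen_le_trefine`, `unit a := ⟨{a}, _⟩` (the fine torus's single
cubes, `u₀ = 0` by pv22's `torusTreeLen_singleton`), constants located at BOTH scales by `torus_consts` ∕ `K₀_four` (ν = 9,
κ₀ = 64·log 162, c₁ = 64, K₀ = `K₀ 64 8` on either torus; `b₅ := 5·r₁`).  In the resulting END the inner labels `⟨W, (𝐃, P)⟩` of a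
COARSE polymer `Z` live on the REFINED footprint: `W ⊆ (trefineDom L N Z).1` (fine cubes of the blocks of `Z`), `𝐃` a covering family of
`(trefineDom L N Z).1 ∖ W` by localization domains of the FINE torus, `P ⊆ bondsOf W`, `#W ≤ 2·#P`; the source (`μ₁`, `μ₀`, `sμ`, `v`)
occurs ONLY in `hH`, `hact`, `hAmp` and the conclusion; NO footprint map, NO `hmono`, NO link binder, NO geometry hypothesis remain.
WHAT STAYS DISPLAYED: the operator letters `hm`∕`hN`∕`hq`, room, class radii (source radius `μ₁‖v‖` in `hH`), `hscale`∕`hact`; `hadm`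
(the terms of `Z` ARE inner labels of its refined footprint — (B1b) READING); (B3-amp) `hAmp` — THE place where the dressed radius and the
source enter, p. 18's clause KIND at `C₃(E₀ + D₀)`, NOT asserted (G-ne9p2-5 UNPRINTED); the bonds-per-cube clause `hb₀`∕`bondsOf`;
`hs0`∕`hs1`∕`ht`; the located clauses `64·log 162 + 1 ≤ δκ`, `e·K₀(64,8)·64·α₆ ≤ 1`, `r₁ + 2·(64·log 162) + 2 ≤ Rkp ≤
R − 64·(e^{5R}·s·e^{b₀t})`, `A·e^{5r₁+1}·K₀(64,8)·9·64 ≤ 1` ((B5): SHAPES consumed BY NAME — pv22's cite-tagged `ineq229_torus_unit`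
letters; their standing against print's NUMBERS is NOT asserted); the μ-window `0 < μ₀ < μ₁`, `‖sμ‖ ≤ μ₀`.  WHICH pair `(N, L·N)` of nested
tori is Bałaban's `(𝐃_{k+1}, 𝐃_k)` and `L` his scaling integer stay pv22's READING (DIVERGENCE D-pv22.3), not asserted; print's (2.32)
constant `4` vs the typed `5` = S40's record (G-B13-08), TYPE∕CONTEXT; the μ-extension is the owner's, UNPRINTED (GAPS-T4 C-t4r2-340
(n1)∕(n2)).

PRINTED LOCI (TYPE ∕ CONTEXT only — [Balaban1988RGII] = T. Bałaban, Renormalization group approach to lattice gauge field theories. II,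
Commun. Math. Phys. 116 (1988) 1–22: (2.27)–(2.34) pp. 17–19, (2.36) p. 19; [Balaban1987RGI] = CMP 109 (1987) p. 251 (ONE torus;
π_{k+1}-cubes = blocks of L⁴ cubes of π_k); [Dimock2013] = arXiv:1304.0705 §3 Lemma 10 (`L·d_{LM}(X̄′) ≤ d_M(X̄)`) — quoted in the imported
modules' headers (N0x, N0u, S40.1, S43.1, S48, pv22's cite-tagged `TreeLengthTorus*`) from the renders read by t4-ref2 (pass 86
C-t4r2-407), re-asserted nowhere here; no new render reading is claimed.

HONEST FRAMING (c3∕c4∕c6∕k1–k3).  Kernel bookkeeping: ONE by-name application joining this seat's S66 §1 with S43.1's landed refinement;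
the cores ∕ inner labels are the cell's typed FORMAT of (2.14) and of print's second resummation step, NOT Bałaban's functions; 0 binders
instantiated on Bałaban's densities; no new inequality; (B1b) ∕ (B3-amp) ∕ (B3-form) ∕ (B5) for Bałaban's objects NOT discharged; no wall
item moves; the NE1′ wall wording of record v1.8 (T4-DAG v48–v53) — words, not kind — does NOT move; R-t4r2-Q2 NOT met thereby; NE1′ ⇐ the
named binders — NOT printed, NOT proved; spine PROVED 0∕9; count 9 unchanged.  ABSOLUTE RULE honoured: printed loci TYPE ∕ CONTEXT only,
nothing internally minted is cited, [folklore] tags on kernel lemmas only, no placeholders; `FlowStep.BetaPertH` ∕ (B) ∕ (B^μ) ∕ G-an2-4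
enter nowhere.  Rung (B)+1 on ONE finite four-torus — NOT infinite volume, NOT a mass gap, NOT OS on ℝ⁴, NOT Clay.  HONEST DEPENDENCY:
continuum YM on T⁴ ⇐ BetaPertH ∧ nine spine estimates (0/9 proved); BetaPertH ⇐ (D1) ∧ (D4) ∧ CAP+tail; G-an2-4 gates asym, D1 and
NE2/3/4. -/
noncomputable section

namespace Summit.QuantumFields.BalabanUV.T4Continuum.NE1p.DressedSmallFieldInnerLabelsRefinedMu

open Metric Set Complex MeasureTheory
open scoped BigOperators
open Literature.MathematicalPhysics.QuantumFieldTheory.Balaban1983to89.T4OutputRate (Carriers)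
open Literature.MathematicalPhysics.QuantumFieldTheory.Balaban1983to89.B13Resummation (locE)
open Literature.MathematicalPhysics.QuantumFieldTheory.Balaban1983to89.B13FamilySum (coveringFamilies)
open Literature.MathematicalPhysics.QuantumFieldTheory.Balaban1983to89.TreeLengthTorus (TPt TDom IsTDom tsys torusTreeLen
  torusTreeLen_singleton)
open Literature.MathematicalPhysics.QuantumFieldTheory.Balaban1983to89.TreeLengthTorusGeometry (TTouch tgeometry)
open Literature.MathematicalPhysics.QuantumFieldTheory.Balaban1983to89.B12TreeDecay (K₀)
open Summit.QuantumFields.BalabanUV.T4Continuum.B13HistMeasurable (MeasPotFrame B13HistM)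
open Summit.QuantumFields.BalabanUV.T4Continuum.B13TermParamGaussianBi (BiCore)
open Summit.QuantumFields.BalabanUV.T4Continuum.TorusBlockRefinement (trefineDom torusTreeLen_le_trefine)
open Summit.QuantumFields.BalabanUV.T4Continuum.NE1p.DressedSmallFieldLinkMu (muPart_locE_le_of_coresAt_pencil_innerLabels_of_units)
open Summit.QuantumFields.BalabanUV.T4Continuum.NE1p.DressedSmallFieldGeometry (torus_consts)
open Summit.QuantumFields.BalabanUV.T4Continuum.NE1p.DressedSmallFieldGeometryFaces (K₀_four)

variable {N : ℕ} [NeZero N] {L : ℕ} [NeZero L]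
variable {C : Carriers} {P : MeasPotFrame C} {Op : Type*} [NormedAddCommGroup Op] [NormedSpace ℂ Op] {Bnd : Type} [DecidableEq Bnd]
  {𝒴 : ℕ → (Σ _ : Finset (TPt 4 (L * N)), Finset (TDom 4 (L * N)) × Finset Bnd) → Type*} {dom : ∀ k i, 𝒴 k i → C.Dom}
  {β : ℕ → (Σ _ : Finset (TPt 4 (L * N)), Finset (TDom 4 (L * N)) × Finset Bnd) → Type*} [∀ k i, MeasurableSpace (β k i)]
  {α : ℕ → (Σ _ : Finset (TPt 4 (L * N)), Finset (TDom 4 (L * N)) × Finset Bnd) → Type*} [∀ k i, NormedAddCommGroup (α k i)]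
  [∀ k i, InnerProductSpace ℝ (α k i)] [∀ k i, FiniteDimensional ℝ (α k i)] [∀ k i, MeasurableSpace (α k i)]
  [∀ k i, BorelSpace (α k i)]

open Classical in
/-- **N0x PART 2's INNER-LABEL μ-END ON THE NESTED TORI `(N, L·N)` — NO FOOTPRINT MAP, NO `hmono`, NO LINK BINDER, NO GEOMETRY
HYPOTHESIS** (kernel; S66 §1 `muPart_locE_le_of_coresAt_pencil_innerLabels_of_units` ONCE BY NAME at `D := tsys 4 N`, `G := tgeometry
4 N`, `Dk := tsys 4 (L·N)`, `Gk := tgeometry 4 (L·N)`, `foot := trefineDom L N`, `hmono := torusTreeLen_le_trefine` (S43.1), the fine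
torus's single cubes as unit domains (`u₀ = 0`), constants located at both scales): cores indexed by inner labels `⟨W, (𝐃, P)⟩` of the
REFINED footprint `(trefineDom L N Z).1` (`hadm`), per-label AMPLITUDE `hAmp` at the source radius `‖h₀‖ + μ₁‖v‖`, bonds-per-cube clause
`hb₀`, the located clauses and rate bookkeeping `Rkp ≤ R − 64·(e^{5R}·s·e^{b₀t})`; for `0 < μ₀ < μ₁`, `‖sμ‖ ≤ μ₀` the μ-part is
`≤ e·9·64·K₀(64,8)²·A·e^{−r₁·torusTreeLen X₀}·μ₀∕(μ₁ − μ₀)` (coarse tree length of `X₀`). [folklore] -/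
theorem muPart_locE_le_of_coresAt_pencil_innerLabels_refined {Win : Set (ℕ → ℝ)}
    {ctr : ℕ → (ℕ → ℝ) → C.BgB → Op × B13HistM P} {ROp RHist R' : ℕ → ℝ}
    (𝔊 : ∀ k i, C.Dom → BiCore P (dom k i) Op (β k i) (α k i))
    {mq bq N₀ : ℕ → (Σ _ : Finset (TPt 4 (L * N)), Finset (TDom 4 (L * N)) × Finset Bnd) → C.Dom → ℝ}
    (hroom : ∀ k, ROp k < R' k)
    (hm : ∀ k, ∀ g ∈ Win, ∀ (U : C.BgB) (X : C.Dom), C.scale X = k → ∀ i, 0 < mq k i X)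
    (hN : ∀ k, ∀ g ∈ Win, ∀ (U : C.BgB) (X : C.Dom), C.scale X = k → ∀ i,
      (∀ o ∈ ball (ctr k g U).1 (R' k), AEStronglyMeasurable ((𝔊 k i X).N o) (𝔊 k i X).lam) ∧
      (∀ p, DifferentiableOn ℂ (fun o => (𝔊 k i X).N o p) (ball (ctr k g U).1 (R' k))) ∧
      (∀ o ∈ ball (ctr k g U).1 (R' k), ∀ p, ‖(𝔊 k i X).N o p‖ ≤ N₀ k i X))
    (hq : ∀ k, ∀ g ∈ Win, ∀ (U : C.BgB) (X : C.Dom), C.scale X = k → ∀ i,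
      (∀ o ∈ ball (ctr k g U).1 (R' k),
        AEStronglyMeasurable (Function.uncurry ((𝔊 k i X).q o)) ((𝔊 k i X).lam.prod volume)) ∧
      (∀ p v, DifferentiableOn ℂ (fun o => (𝔊 k i X).q o p v) (ball (ctr k g U).1 (R' k))) ∧
      (∀ o ∈ ball (ctr k g U).1 (R' k), ∀ p v, mq k i X * ‖v‖ ^ 2 - bq k i X ≤ ((𝔊 k i X).q o p v).re))
    {k : ℕ} {g : ℕ → ℝ} (hg : g ∈ Win) {U : C.BgB} {o : Op} {h₀ v : B13HistM P} {μ₁ : ℝ}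
    (hO : ‖o - (ctr k g U).1‖ ≤ ROp k) (hH : ‖h₀ - (ctr k g U).2‖ + μ₁ * ‖v‖ ≤ RHist k)
    {emb : (tsys 4 N).Dom → C.Dom} (hscale : ∀ Z, C.scale (emb Z) = k)
    {terms : (tsys 4 N).Dom → Finset (Σ _ : Finset (TPt 4 (L * N)), Finset (TDom 4 (L * N)) × Finset Bnd)}
    {act : ℂ → (tsys 4 N).Dom → ℂ}
    (hact : ∀ σ ∈ ball (0 : ℂ) μ₁, ∀ Z, act σ Z = ∑ i ∈ terms Z, (𝔊 k i (emb Z)).termAt o (h₀ + σ • v))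
    {A Rkp r₁ μ₀ : ℝ} (X₀ : (tsys 4 N).Dom) {sμ : ℂ} (hA : 0 ≤ A) (hr₁ : 0 ≤ r₁)
    (hrate : r₁ + 2 * (64 * Real.log 162) + 2 ≤ Rkp) (hsmall : A * Real.exp (5 * r₁ + 1) * K₀ 64 8 * 9 * 64 ≤ 1)
    (bondsOf : Finset (TPt 4 (L * N)) → Finset Bnd) {δ κ α₆ R b₀ s t : ℝ} (hα₆ : 0 ≤ α₆)
    (hκ : 64 * Real.log 162 + 1 ≤ δ * κ) (h229 : Real.exp 1 * K₀ 64 8 * 64 * α₆ ≤ 1)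
    (hs0 : 0 ≤ s) (hs1 : s ≤ 1) (ht : 0 ≤ t) (hb₀ : ∀ W, ((bondsOf W).card : ℝ) ≤ b₀ * W.card)
    (hRR : Rkp ≤ R - 64 * (Real.exp (R * 5) * s * Real.exp (b₀ * t)))
    (hadm : ∀ Z : (tsys 4 N).Dom, ∀ l ∈ terms Z, l.1 ⊆ (trefineDom L N Z).1 ∧
      l.2.1 ∈ coveringFamilies Finset.univ (fun Y : (tsys 4 (L * N)).Dom => Y.1) ((trefineDom L N Z).1 \ l.1) ∧
        l.2.2 ⊆ bondsOf l.1 ∧ l.1.card ≤ 2 * l.2.2.card)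
    (hAmp : ∀ Z : (tsys 4 N).Dom, Z.1 ⊆ X₀.1 → ∀ l ∈ terms Z,
      (𝔊 k l (emb Z)).lam.real univ * ((𝔊 k l (emb Z)).wB * N₀ k l (emb Z) * Real.exp (bq k l (emb Z))) *
          (Real.pi / (mq k l (emb Z) / 2)) ^ (Module.finrank ℝ (α k l) / 2 : ℝ) *
        Real.exp ((𝔊 k l (emb Z)).N₁ * (‖h₀‖ + μ₁ * ‖v‖)) ≤
      A * ((∏ Y ∈ l.2.1, (α₆ * Real.exp (-(δ * κ * torusTreeLen Y.1)) *
        Real.exp (-(R * (torusTreeLen Y.1 + 5))))) * (s ^ 2 * t) ^ l.2.2.card))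
    (h0 : 0 < μ₀) (h01 : μ₀ < μ₁) (hμ : ‖sμ‖ ≤ μ₀) :
    ‖locE (TTouch (d := 4) (N := N)) (fun Z : (tsys 4 N).Dom => Z.1) (act sμ) X₀.1 -
        locE (TTouch (d := 4) (N := N)) (fun Z : (tsys 4 N).Dom => Z.1) (act 0) X₀.1‖ ≤
      Real.exp 1 * 9 * 64 * K₀ 64 8 ^ 2 * A * Real.exp (-(r₁ * torusTreeLen X₀.1)) * (μ₀ / (μ₁ - μ₀)) := by
  obtain ⟨hν, hκ₀, hc⟩ := torus_consts N
  obtain ⟨-, hκ₀L, hcL⟩ := torus_consts (L * N)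
  have hK₀ := K₀_four (N := N)
  have hK₀L := K₀_four (N := L * N)
  have hdom : ∀ a : TPt 4 (L * N), IsTDom ({a} : Finset (TPt 4 (L * N))) := fun a =>
    ⟨Finset.singleton_nonempty a, fun x hx y hy => by
      rw [Finset.mem_singleton] at hx hy; subst hx; subst hy; exact Relation.ReflTransGen.refl⟩
  have h := muPart_locE_le_of_coresAt_pencil_innerLabels_of_units (tsys 4 N) (tgeometry 4 N) (tgeometry 4 (L * N)) 𝔊 hroom hm
    hN hq hg hO hH hscale hact (Rkp := Rkp) (b₅ := 5 * r₁) (X₀ := X₀) (sμ := sμ) hA hr₁ (le_of_eq (by ring))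
    (by rw [hκ₀]; exact hrate) (by rw [hK₀, hν, hc]; exact hsmall) (trefineDom L N) (fun Z => torusTreeLen_le_trefine Z) bondsOf hα₆
    (by rw [hκ₀L]; exact hκ) (by rw [hK₀L, hcL]; exact h229) hs0 hs1 ht hb₀
    (fun a => (⟨{a}, hdom a⟩ : TDom 4 (L * N))) (fun _ => rfl) (u₀ := 0) (fun a => le_of_eq (torusTreeLen_singleton a))
    (by rw [hcL, show (5 : ℝ) + 0 = 5 by norm_num]; exact hRR) hadm hAmp h0 h01 hμ
  rw [hν, hc, hK₀] at h
  exact h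

end Summit.QuantumFields.BalabanUV.T4Continuum.NE1p.DressedSmallFieldInnerLabelsRefinedMu

end
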